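import Summits.QuantumFields.YangMills.Theorems.UnitScaleTiltProp7Chart47T3Defs
import Literature.MathematicalPhysics.QuantumFieldTheory.Balaban1983to89.B9Ineq3137LocalSup
import HarnessLib

/-!
# Route `UnitScaleTilt`, crux K1 child «MinimiserStabilityRegPr» (stmt-QuantumFields-19200), skeleton v10 stub EX, route (α), cut (S3)(i) — **CHART-47-T³ PROVED:
# [Balaban1985Variational] PROPOSITION 3 (the linearizing transformation (47) `A = A′ − HD(A′)`, «defined … range contains (43) with ε₂ ≦ ¼ε₃ … contained in … 2ε₃ …
# (55)») AT THE T³ OBJECTS IN THE BASED LETTERS OF `S_print`, PORTED FROM `B11Prop3Concrete.prop3_concrete` (ℤᵈ carrier, concrete `C_k`, abstract `H`) BY LOCALITY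
# (`B9Ineq3137LocalSup.CCovIter_congr`) AND THE PERIODIC BASED PULLBACK** — and the composition `Chart112T3 ⇐ Chart47T3 ∧ ChartSigmaT3 ∧ Chart5T3` of the (S3)(i) split
# (★★OWNER 02:08:50Z (2)–(3), 02:15:05Z)

Cell `ym3-torus` ∕ width seat `ym-ust-19200-w1` (gen 2).  YM₃ on T³ is ladder rung R3, not the Clay problem; nothing here is a claim about the crux or the gap.

WHY ∕ HOW.  `prop3_concrete` proves Prop. 3 for the concrete remainder `C_j(U₀, ·)` of [4] on finite sets `S` (fine) ∕ `T` (coarse) of `ℤᵈ` bonds, sup norms, for every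
linear `H` with ‖HX‖ ≤ B₀‖X‖, in the regime of `B7Eq136SecondOrder` (regular `G`-valued background, plaquettes `< α₀L^{−2k}`, Prop.-4∕5 smallness of the radius).  At a T³
member (`F`, `n < K`, `k = K − n`) with background `U₀ ∈ 𝔘_k(a)` (`RegPr`): the based pullback `U₀♯ = pull (bgUnits F K U₀) x₀` is `SU(2)`-valued (`pull_toUField_mem`),
`AvgClosed` (`avgClosed_specialUnitary_of_le_twentyone`) and has plaquettes `< 2a·L^{−2k}` (`Prop7AxialReprPrint.pdev_pull_lt` ∘ `inAk_pull_of_regPr`); take `S = fineBox`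
(`[−N, 2N)³`, `N = sitesPerDir 0`), `T = coarseBox` (one period `[0, N_k)³` of level-`k` bonds), read fine torus fields on `S` through `resPull` (sup norm PRESERVED,
`norm_resPull`: the box contains the least-absolute-value representatives `rel x₀ ·`) and `H` on `S` as `resPull ∘ H`; then (49) on `S` is (49) on the torus because
`insCfg S (resPull Φ)` agrees with `Φ♯` on every averaging cone `B^k(c₋) ∪ B^k(c₊) ⊂ [0, N + Lᵏ) ³ ⊂ S` (`agreeOn_insCfg_resPull`, `N = N_k·Lᵏ` by
`Prop7FlatHolonomy.sitesPerDir_zero_eq_mul_pow`) and `C_k` is local (`CCovIter_congr`); the range and size clauses transfer along `resPull` (linear, norm-preserving,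
`A′ := A + H(D a′)` has `resPull A′ = a′`).

WHAT IS PROVED (sorry-free, no definition).  §1 `rel_mem_fineBox`, **`norm_resPull`** (‖resPull A‖ = ‖A‖), **`agreeOn_insCfg_resPull`**; §2 ★ **`chart47T3_of_regPr`** —
`Chart47T3 F n K a ε U₀ H` from `RegPr F n K a U₀`, ‖HX‖ ≤ B₀‖X‖ and print's «ε₃ sufficiently small (e.g. 18C₂B₀dc₁(½)ε₃ ≦ 1, 2ε₃ ≦ c₄)» made explicit EXACTLY as
`prop3_concrete`'s windows at `α₀ = 2a`, `j = k = K − n` (displayed numeric hypotheses; `c₁(½) := 1`); §3 **`chart112_of_chart47_chartSigma_chart5`** — the composition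
`Chart47T3 → ChartSigmaT3 e → Chart5T3 → (M(ε₄ + ‖H₁B‖) < e, 0 ≤ M) → Chart112T3` (the Σ_k form of (20) assembled from the restricted axial fixing and the fibre clause;
`U₁ = e^{iX}` bondwise pins `U₁ = expHermField X`).

HONEST SCOPE.  Prop. 3's chart is PROVED here at the T³ objects (modulo the abstract letter `H` with its (46) bound — [5] Thm 3.12, in-edge N06 — exactly as in
`B11Prop3Concrete`); `ChartSigmaT3` and `Chart5T3` are displayed hypotheses of §3; nothing of (112)'s second-order bounds (123)–(140), of the Σ_k bridge, of C-min, of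
the stub EX, the crux or the gap is claimed.  The analyticity clause and the (73) derivative bound of `prop3_concrete` are available from the same port and omitted (they
serve Prop. 4, not the chart row).  Count-neutral helper toward stmt-QuantumFields-19200 (`--supports`); nothing continuum ∕ OS ∕ mass-gap ∕ Clay.

References: T. Bałaban, CMP **102** (1985) 277–309 [Balaban1985Variational] ((43)–(49) p.285, (51)–(55) p.286, Prop. 3 p.289, (112) p.294); CMP **98** (1985) 17–51
[Balaban1985Averaging] ((43) p.24 + the locality sentence after it, (127) p.37, Props 4–5 pp.38–42, (150) p.40); CMP **99** (1985) 75–102 [Balaban1985RegularSpaces]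
((1.3) p.77, (1.7) p.77, (1.19) p.79, (1.29) p.81); [Balaban1987RG1] (0.1) p.251.
-/

noncomputable section

open scoped Matrix.Norms.L2Operator

namespace Summit.QuantumFields.YangMills.Theorems.Prop7ChartT3

open Literature.MathematicalPhysics.QuantumFieldTheory.Balaban1983to89
open T3ContinuumYM3Torus
open T3PrintedRegularMinimiser (RegPr)
open T3UnitLawDensityEML (ℰp)
open T3ConstrainedMinimiser (fibre)
open T3SectALandauChart (bgUnits emb15)
open B7Prop1Explicit renaming Site → LSite
open B7Prop1Explicit (e)
open B7Prop1Local (InBox AgreeOn loK bondHiK)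
open B7Prop2Explicit (pdev C0 c2')
open B7Prop2SpecialUnitary (specialUnitaryUnits)
open B7AvgClosedSpecialUnitarySharp (avgClosed_specialUnitary_of_le_twentyone)
open B7Prop3Flat (insCfg c3)
open B7Prop5GeneralLevels (thetaGen C3Gen)
open B7Prop5GeneralInduction (CCovIter)
open B9Ineq3137LocalSup (CCovIter_congr)
open B9SectCLatticeCarrier (Bond)
open B11Eq44Concrete (Cmap)
open B11Prop3Model (Dfix)
open B11Prop3Concrete (prop3_concrete)
open B11Eq115Space (NegSize Space115)
open B11Eq111FrakG (nabla115)
open B11Eq98CurrentSlot (Jcur)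
open B10Eq27TorusAxialLog (pull pull_apply transl rel transl_rel natAbs_rel_le unitsField toUField)
open Summit.QuantumFields.YangMills.Theorems.Prop7SectET3Transport (periodsT3 bgOfCfg)
open Summit.QuantumFields.YangMills.Theorems.Prop7SPrint (basePt IsAxialPrint RestrictedPrint AvgCondPrint IsLandauPrint)
open Summit.QuantumFields.YangMills.Theorems.Prop7TPrint (nMax19 expHermField expHermField_apply coe_expHerm)
open Summit.QuantumFields.YangMills.Theorems.Prop7AxialReprPrint (pdev_pull_lt inAk_pull_of_regPr pull_toUField_mem)
open Summit.QuantumFields.YangMills.Theorems.Prop7FlatHolonomy (sitesPerDir_zero_eq_mul_pow)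

variable (F : T3Family) (n K : ℕ)

/-! ## §1 The based pullback on one period: representatives, the sup norm, locality meets periodicity -/

/-- **Every least-absolute-value representative lies in the fine box** (`|rel x₀ x|_i ≤ N/2 < 2N`, `−N ≤ −N/2`). [cite: Balaban1987RG1, (0.1) p.251] -/
theorem rel_mem_fineBox (x : Site (F.P K) 0) (κ : Fin (F.P K).d) : (rel (basePt F n K) x, κ) ∈ fineBox F K := by
  rw [mem_fineBox_iff]
  intro i
  have h := natAbs_rel_le (basePt F n K) x i
  have habs : |rel (basePt F n K) x i| ≤ (((F.P K).sitesPerDir 0 / 2 : ℕ) : ℤ) := by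
    rw [← Int.natCast_natAbs]; exact_mod_cast h
  obtain ⟨h1, h3⟩ := abs_le.1 habs
  have hN0 : 0 < (F.P K).sitesPerDir 0 := Nat.pos_of_ne_zero ((F.P K).sitesPerDir_ne_zero 0)
  constructor
  · omega
  · omega

/-- **THE SUP NORM OF THE RESTRICTED PULLBACK IS THE SUP NORM OF THE TORUS FIELD**: every box value is a torus value, and every torus bond `b` is the pullback bond at
`(rel x₀ b₋, dir b) ∈ fineBox` (`transl_rel`). [cite: Balaban1985Averaging, (8) p.19; Balaban1985Variational, (43) p.285] -/
theorem norm_resPull (A : PBond (F.P K) 0 → Matrix (Fin 2) (Fin 2) ℂ) : ‖resPull F n K A‖ = ‖A‖ := by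
  apply le_antisymm
  · refine (pi_norm_le_iff_of_nonneg (norm_nonneg A)).2 fun s => ?_
    rw [resPull_apply]
    exact norm_le_pi_norm A _
  · refine (pi_norm_le_iff_of_nonneg (norm_nonneg _)).2 fun b => ?_
    have hb : b = ⟨transl (basePt F n K) (rel (basePt F n K) b.src), b.dir⟩ := by
      rw [transl_rel]
    have hmem := rel_mem_fineBox F n K b.src b.dir
    calc ‖A b‖ = ‖resPull F n K A ⟨(rel (basePt F n K) b.src, b.dir), hmem⟩‖ := by
          rw [resPull_apply]; exact congrArg (fun b' => ‖A b'‖) hb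
      _ ≤ ‖resPull F n K A‖ := norm_le_pi_norm _ _

/-- **LOCALITY MEETS PERIODICITY**: on the averaging cone `B^k(c₋) ∪ B^k(c₊)` ([4] p. 24) of a coarse bond `c` of the coarse box, the field inserted on the fine box from
the restricted pullback (`B7Prop3Flat.insCfg`, zero off the box) AGREES with the full periodic pullback — the cone lies in `[0, N + Lᵏ)³ ⊂ [−N, 2N)³`, `N = N_k·Lᵏ`.
[cite: Balaban1985Averaging, p.24 (sentence after (43)); Balaban1985RegularSpaces, (1.3) p.77] -/
theorem agreeOn_insCfg_resPull (hnK : n ≤ K) (Φ : PBond (F.P K) 0 → Matrix (Fin 2) (Fin 2) ℂ) {z : LSite (F.P K).d} {κ : Fin (F.P K).d}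
    (hz : (z, κ) ∈ coarseBox F n K) :
    AgreeOn (loK (F.P K).L (K - n) z) (bondHiK (F.P K).L (K - n) z κ)
      (insCfg (fineBox F K) (resPull F n K Φ)) (pull Φ (basePt F n K)) := by
  intro x κ' hx _
  have hmem : (x, κ') ∈ fineBox F K := by
    rw [mem_fineBox_iff]
    rw [mem_coarseBox_iff] at hz
    have hk : K - n ≤ (F.P K).m + (F.P K).K := by
      have : (F.P K).K = K := rfl
      omega
    have hN : (F.P K).sitesPerDir 0 = (F.P K).sitesPerDir (K - n) * (F.P K).L ^ (K - n) := sitesPerDir_zero_eq_mul_pow hk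
    have hNk : 0 < (F.P K).sitesPerDir (K - n) := Nat.pos_of_ne_zero ((F.P K).sitesPerDir_ne_zero (K - n))
    have hP : 0 < (F.P K).L ^ (K - n) := Nat.pow_pos (F.P K).L_pos
    intro i
    obtain ⟨hlo, hhi⟩ := hx i
    simp only [loK] at hlo
    simp only [bondHiK] at hhi
    obtain ⟨hz0, hz1⟩ := hz i
    have hNz : (((F.P K).sitesPerDir 0 : ℕ) : ℤ) = (((F.P K).sitesPerDir (K - n) : ℕ) : ℤ) * ((F.P K).L : ℤ) ^ (K - n) := by
      rw [hN]; push_cast; ring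
    set Pk : ℤ := ((F.P K).L : ℤ) ^ (K - n) with hPk
    have hPk0 : 0 < Pk := by rw [hPk]; exact_mod_cast hP
    have hzle : z i ≤ (((F.P K).sitesPerDir (K - n) : ℕ) : ℤ) - 1 := by omega
    have h1 : Pk * z i ≤ Pk * ((((F.P K).sitesPerDir (K - n) : ℕ) : ℤ) - 1) := mul_le_mul_of_nonneg_left hzle hPk0.le
    have h2 : 0 ≤ Pk * z i := mul_nonneg hPk0.le hz0
    have h3 : Pk ≤ (((F.P K).sitesPerDir (K - n) : ℕ) : ℤ) * Pk := by
      have : (1 : ℤ) ≤ (((F.P K).sitesPerDir (K - n) : ℕ) : ℤ) := by exact_mod_cast hNk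
      nlinarith
    have hite : (if i = κ then ((F.P K).L : ℤ) ^ (K - n) else 0) ≤ Pk := by
      split_ifs
      · exact le_rfl
      · exact hPk0.le
    constructor
    · nlinarith
    · nlinarith
  show insCfg (fineBox F K) (resPull F n K Φ) x κ' = pull Φ (basePt F n K) x κ'
  simp only [insCfg, dif_pos hmem]
  rfl

/-! ## §2 CHART-47-T³ proved: the port of `B11Prop3Concrete.prop3_concrete` -/

/-- ★ **CHART-47-T³ — [Balaban1985Variational] PROPOSITION 3 AT THE T³ OBJECTS (based letters), PROVED.**  For a member (`F`, `n < K`, `k = K − n`), a background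
`U₀ ∈ 𝔘_k(a)` (`RegPr F n K a U₀`, both clauses of (2)), an abstract linear `H` from coarse data on one period of `Λ_k` to fine torus fields with ‖HX‖ ≤ B₀‖X‖ ((46),
[5] Thm 3.12 — displayed), a radius `b` of [4] Props 4–5's regime and print's «ε₃ sufficiently small» as the explicit windows of `prop3_concrete` at `α₀ = 2a`, `j = k`
(`18·C₂(Lᵏ)²·B₀·d·ε ≤ 1`, `2ε ≤ b/2`, and the background windows `C₀·2a ≤ ⅓`, `8a ≤ c₂′`, (145), (155), `4Lᵏb < c₃`, the exponential window): `Chart47T3 F n K a ε U₀ H`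
— (49) at every coarse bond of the period for the concrete `C_k` of the based pullbacks, the range sandwich `(43)_{ε/4} ⊆ range ⊆ (43)_{2ε}`, and (55).
[cite: Balaban1985Variational, Prop. 3 p.289, (47)–(49) p.285, (55) p.286; Balaban1985Averaging, Prop. 4 (134)–(135) p.38, Prop. 5 p.42, p.24] -/
theorem chart47T3_of_regPr (hnK : n < K) {a b ε B₀ : ℝ} (ha : 0 < a) (hb : 0 < b) (hε : 0 < ε) (hB₀ : 0 ≤ B₀)
    (U₀ : GaugeField (F.P K) 0 (Matrix.specialUnitaryGroup (Fin 2) ℂ)) (hreg : RegPr F n K a U₀)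
    (hα3 : C0 (F.P K).d * (2 * a) ≤ 1 / 3) (hα4 : 4 * (2 * a) ≤ c2' (F.P K).d (F.P K).L)
    (hsmall : Real.exp (4 * (800 * (((F.P K).d : ℝ) + 1) ^ 2 * (((F.P K).d : ℝ) + 4)) * (2 * a))
      * (1 + 8 * (131072 * (((F.P K).d : ℝ) + 1) ^ 2) * (((F.P K).L : ℝ) ^ (K - n) * b)) ≤ 2)
    (hc₃ : 4 * (((F.P K).L : ℝ) ^ (K - n) * b) < c3 (F.P K).d (F.P K).L)
    (h145 : 8 * (F.P K).d * thetaGen (F.P K).d (F.P K).L (2 * a) * ((F.P K).L : ℝ)⁻¹ ^ 4 ≤ 1)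
    (h155 : (2 * ((F.P K).L : ℝ) - 1) * ((F.P K).L : ℝ)⁻¹ ^ 2 + 2 * (F.P K).d * thetaGen (F.P K).d (F.P K).L (2 * a) * ((F.P K).L : ℝ)⁻¹ ^ 3
      + 1 / 8 * (1 + 2 * (F.P K).d * thetaGen (F.P K).d (F.P K).L (2 * a) * ((F.P K).L : ℝ)⁻¹ ^ 2
        + 2 * (F.P K).d * C3Gen (F.P K).d (F.P K).L * (((F.P K).L : ℝ) ^ (K - n) * b)) * ((F.P K).L : ℝ)⁻¹ ^ 2 ≤ 1)
    (h18 : 18 * C2K F n K a * B₀ * (F.P K).d * 1 * ε ≤ 1) (h2 : 2 * ε ≤ b / 2)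
    (H : (↥(coarseBox F n K) → Matrix (Fin 2) (Fin 2) ℂ) →ₗ[ℂ] (PBond (F.P K) 0 → Matrix (Fin 2) (Fin 2) ℂ))
    (hH : ∀ X, ‖H X‖ ≤ B₀ * ‖X‖) :
    Chart47T3 F n K a ε U₀ H := by
  -- the regime of `prop3_concrete` at the based pullback
  have hL2 : 2 ≤ (F.P K).L := by
    obtain ⟨c, hc⟩ := F.hL.1
    have h1 := F.hL.2
    show 2 ≤ F.L
    omega
  have hL1 : 1 ≤ (F.P K).L := le_trans (by norm_num) hL2
  have hd : 1 ≤ (F.P K).d := by rw [T3Family.P_d]; norm_num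
  have hG := avgClosed_specialUnitary_of_le_twentyone (N := 2) (by norm_num) (F.P K).d (F.P K).L
  have hU₀mem : ∀ x κ, pull (bgUnits F K U₀) (basePt F n K) x κ ∈ specialUnitaryUnits (Fin 2) := pull_toUField_mem U₀ (basePt F n K)
  have hα : 0 < 2 * a := by positivity
  have h52 : pdev (pull (bgUnits F K U₀) (basePt F n K)) < 2 * a * ((((F.P K).L : ℝ) ^ (K - n))⁻¹) ^ 2 :=
    pdev_pull_lt ha (inAk_pull_of_regPr F ha.le hreg) (basePt F n K)
  have hHSn : ∀ X, ‖((resPull F n K) ∘ₗ H) X‖ ≤ B₀ * ‖X‖ := fun X => by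
    rw [LinearMap.comp_apply, norm_resPull]; exact hH X
  have h18' : 18 * ((8 * (131072 * (((F.P K).d : ℝ) + 1) ^ 2) * Real.exp (4 * (800 * (((F.P K).d : ℝ) + 1) ^ 2 * (((F.P K).d : ℝ) + 4)) * (2 * a)))
      * (((F.P K).L : ℝ) ^ (K - n)) ^ 2) * B₀ * (F.P K).d * 1 * ε ≤ 1 := h18
  obtain ⟨h49, -, hrange, h57, h55, -⟩ :=
    prop3_concrete (F.P K).L hL2 hG (K - n) (pull (bgUnits F K U₀) (basePt F n K)) hU₀mem hα hα3 hα4 h52 hb hsmall hc₃ h145 h155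
      (fineBox F K) (coarseBox F n K) ((resPull F n K) ∘ₗ H) le_rfl hd hB₀ hHSn (le_refl (1 : ℝ)) hε h18' h2
  refine ⟨?_, ?_, ?_, ?_⟩
  · -- (49) on the torus: locality + periodicity
    intro A' hA' c
    have ha' : ‖resPull F n K A'‖ < ε := by rw [norm_resPull]; exact hA'
    have e49 := congrFun (h49 (resPull F n K A') ha') c
    rw [B11Eq44Concrete.Cmap_apply] at e49
    have hsub : resPull F n K A' - ((resPull F n K) ∘ₗ H) (Dmap F n K a U₀ H (resPull F n K A')) =
        resPull F n K (A' - H (Dmap F n K a U₀ H (resPull F n K A'))) := by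
      rw [map_sub, LinearMap.comp_apply]
    change CCovIter (F.P K).L (pull (bgUnits F K U₀) (basePt F n K))
        (insCfg (fineBox F K) (resPull F n K A' - ((resPull F n K) ∘ₗ H) (Dmap F n K a U₀ H (resPull F n K A')))) (K - n) c.1.1 c.1.2 =
        Dmap F n K a U₀ H (resPull F n K A') c at e49
    rw [hsub] at e49
    rw [← e49]
    exact (CCovIter_congr (F.P K).L hL1 (K - n) c.1.1 c.1.2 (fun _ _ _ _ => rfl)
      (agreeOn_insCfg_resPull F n K hnK.le _ c.2)).symm
  · -- «the range … contains the set (43) with ε₂ ≤ ¼ε₃»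
    intro ε₂ hε₂ A hA
    have hA' : ‖resPull F n K A‖ < ε₂ := by rw [norm_resPull]; exact hA
    obtain ⟨a', ha', heq⟩ := hrange ε₂ hε₂ (resPull F n K A) hA'
    change a' - ((resPull F n K) ∘ₗ H) (Dmap F n K a U₀ H a') = resPull F n K A at heq
    have hres : resPull F n K (A + H (Dmap F n K a U₀ H a')) = a' := by
      rw [map_add]
      have : resPull F n K (H (Dmap F n K a U₀ H a')) = ((resPull F n K) ∘ₗ H) (Dmap F n K a U₀ H a') := by
        rw [LinearMap.comp_apply]
      rw [this, ← heq, sub_add_cancel]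
    refine ⟨A + H (Dmap F n K a U₀ H a'), ?_, ?_⟩
    · rw [← norm_resPull F n K, hres]; exact ha'
    · rw [hres, add_sub_cancel_right]
  · -- «… is contained in the corresponding set with 2ε₃»
    intro A' hA'
    have ha' : ‖resPull F n K A'‖ < ε := by rw [norm_resPull]; exact hA'
    have h := h57 (resPull F n K A') ha'
    change ‖resPull F n K A' - ((resPull F n K) ∘ₗ H) (Dmap F n K a U₀ H (resPull F n K A'))‖ < 2 * ε at h
    rw [← norm_resPull F n K, map_sub]
    have : resPull F n K (H (Dmap F n K a U₀ H (resPull F n K A'))) = ((resPull F n K) ∘ₗ H) (Dmap F n K a U₀ H (resPull F n K A')) := by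
      rw [LinearMap.comp_apply]
    rw [this]
    exact h
  · -- (55)
    intro A' hA'
    have ha' : ‖resPull F n K A'‖ < ε := by rw [norm_resPull]; exact hA'
    have h := h55 (resPull F n K A') ha'
    rw [norm_resPull] at h
    exact h

/-! ## §3 The composition of the split: `Chart112T3 ⇐ Chart47T3 ∧ ChartSigmaT3 ∧ Chart5T3` -/

/-- **THE (S3)(i) ROW FROM ITS THREE PRINT ROWS**: Prop. 3's chart at the T³ objects (`Chart47T3`, PROVED in §2), the (1.29)-restricted axial gauge fixing relative to `U₀`
on the (19)-ball of radius `e` (`ChartSigmaT3`, [6] p. 81 ∕ [B11] p. 299), and the displayed remainder (`Chart5T3`: (112) composite + (123)–(140) + fibre∕pin junction) give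
`Chart112T3` with the SAME letters, provided the produced exponents stay in the gauge-fixing ball: `M(ε₄ + ‖H₁B‖) < e`, `0 ≤ M`.  The Σ_k form of (20) (`AvgCondPrint`) is
assembled from the restricted axial representative and the fibre clause; `U₁ = e^{iX}` bondwise pins `U₁ = expHermField X` in `SU(2)`.
[cite: Balaban1985Variational, (112) p.294, Prop. 3 p.289, Prop. 5 p.294, p.299; Balaban1985RegularSpaces, (1.28)–(1.30) p.81] -/
theorem chart112_of_chart47_chartSigma_chart5 (h : n ≤ K) [Fact (0 < (F.L : ℝ))] [Fact (0 < ((F.L : ℝ)⁻¹) ^ (K - n))] {ε₄ M e a ε : ℝ}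
    {V : GaugeField (F.P n) 0 (Matrix.specialUnitaryGroup (Fin 2) ℂ)} {U₀ : GaugeField (F.P K) 0 (Matrix.specialUnitaryGroup (Fin 2) ℂ)}
    {𝒢 : NegSize (F.L : ℝ) (((F.L : ℝ)⁻¹) ^ (K - n)) (fun _ : Bond 3 (periodsT3 F K) => K - n) 3 (Matrix (Fin 2) (Fin 2) ℂ) →L[ℂ]
          Space115 (F.L : ℝ) (((F.L : ℝ)⁻¹) ^ (K - n)) (fun _ : Bond 3 (periodsT3 F K) => K - n) (fun _ : Bond 3 (periodsT3 F K) × Fin 3 => K - n)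
            (nabla115 (((F.L : ℝ)⁻¹) ^ (K - n)) (bgOfCfg F K U₀))}
    {W : Space115 (F.L : ℝ) (((F.L : ℝ)⁻¹) ^ (K - n)) (fun _ : Bond 3 (periodsT3 F K) => K - n) (fun _ : Bond 3 (periodsT3 F K) × Fin 3 => K - n)
            (nabla115 (((F.L : ℝ)⁻¹) ^ (K - n)) (bgOfCfg F K U₀)) →
          NegSize (F.L : ℝ) (((F.L : ℝ)⁻¹) ^ (K - n)) (fun _ : Bond 3 (periodsT3 F K) => K - n) 3 (Matrix (Fin 2) (Fin 2) ℂ)}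
    {β : Type} [Fintype β]
    {H₁ : (β → Matrix (Fin 2) (Fin 2) ℂ) →L[ℂ]
          Space115 (F.L : ℝ) (((F.L : ℝ)⁻¹) ^ (K - n)) (fun _ : Bond 3 (periodsT3 F K) => K - n) (fun _ : Bond 3 (periodsT3 F K) × Fin 3 => K - n)
            (nabla115 (((F.L : ℝ)⁻¹) ^ (K - n)) (bgOfCfg F K U₀))}
    {B : β → Matrix (Fin 2) (Fin 2) ℂ}
    {H : (↥(coarseBox F n K) → Matrix (Fin 2) (Fin 2) ℂ) →ₗ[ℂ] (PBond (F.P K) 0 → Matrix (Fin 2) (Fin 2) ℂ)}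
    (h47 : Chart47T3 F n K a ε U₀ H) (hSig : ChartSigmaT3 F n K e U₀) (h5 : Chart5T3 F n K h ε₄ M V U₀ 𝒢 W H₁ B a ε H)
    (hM : 0 ≤ M) (hMe : M * (ε₄ + ‖H₁ B‖) < e) :
    Chart112T3 F n K h ε₄ M V U₀ 𝒢 W H₁ B := by
  intro A₁ hA₁ h111
  obtain ⟨X, hX, hsize, h21, hfib⟩ := h5 h47 A₁ hA₁ h111
  refine ⟨X, hX, hsize, ?_, h21⟩
  -- (20) in the Σ_k form
  have hlt : nMax19 F n K U₀ X < e := by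
    have h1 : M * (‖A₁‖ + ‖H₁ B‖) ≤ M * (ε₄ + ‖H₁ B‖) := mul_le_mul_of_nonneg_left (by linarith) hM
    exact lt_of_le_of_lt (hsize.trans h1) hMe
  obtain ⟨u, hu, hax⟩ := hSig X hX hlt
  intro U₁ hU₁
  have hU₁eq : U₁ = expHermField X := by
    funext b
    apply Subtype.ext
    rw [hU₁ b, expHermField_apply, coe_expHerm (hX b)]
  subst hU₁eq
  exact ⟨u, hu, hax, hfib u hu hax⟩

end Summit.QuantumFields.YangMills.Theorems.Prop7ChartT3

end
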